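import Summits.QuantumAdvantage.QuantumAdvantage.Theorems.NearExactIsExact.Negative.ReflectedPairIdentity

/-!
# `NearExactIsExact` (stmt-QuantumAdvantage-14043) — negative lemma THEOREM D4 (gen 42):
  the derivative of the residual along an affine section is CUBIC — all its ANF coefficients of
  degree `≥ 4` vanish (`15 + 6 + 1` linear constraints per fibre direction, census-free, one-sided)

**Context.** Parts 1–2 of THEOREM ZP (`Negative.ReflectedPairIdentity`, `Negative.ZeroSectionParity`)
extract ONE parity (the top coefficient `[u₀⋯u₅]`) from each of the `r + 1` residual identities of a
configuration `π(u,w) = (γ u, B(u) ⊕ act_u w)` (zero section and the `r` affine sections `tsec_a`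
through `B u ⊕ e_a`). Those `r + 1` parities are necessary conditions only: sampled against the
two-sided system TS of the cube-Z census (DISPROOF.md §48.9) they leave most `(family, g)` cells alive.

**What this file proves (all `r`, ANY base map `γ`, no hypothesis on `B`).** The two residual
identities at `a` say more than a parity: their XOR, the `t_a`-DERIVATIVE
`D_a(u) := c₂(γu, Bu) ⊕ c₂(γu, Bu ⊕ e_a) = c₁(u, 0) ⊕ c₁(u, tsec_a u)`, is a CUBIC function of `u`
(`sectionDerivative_deg`), while its expansion over the fibre-index sets `S ∋ a`, `|S| ≤ 3`
(`tcoef_eq` of THEOREM A's core) is `D_a(u) = ⨁_{S ∋ a} B_{S∖a}(u)·C_S(γu)` — generically of degree `5`.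
By the Ax / McEliece divisibility on subcubes (`stub_axParity` at exponent `⌈|K|/3⌉ ≥ 2`, packaged as
`cube_sum_ind_eq_zero`: a degree-`≤ d` function has even weight on every subcube of dimension `> d`,
i.e. its ANF coefficient `[u_K] = Σ_{supp u ⊆ K} f(u)` vanishes for `|K| > d`):
`sectionDerivative_cube_identity`: for every `K ⊆ Fin 6` with `|K| ≥ 4`,
`Σ_{supp u ⊆ K} Σ_{S ∋ a, |S| ≤ 3} B_{S∖a}(u)·C_S(γu) = 0` in `𝔽₂` (`22` identities per direction `a`;
the zero section gives `zeroSection_cube_identity`: `Σ_{supp u ⊆ K} c₂(γu, Bu) = 1`, `|K| ≥ 4`).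
In cube-Z coordinates (`γ = (ū, u₅ ⊕ g(ū))`, `B` homogeneous quadratic, `|K| = 4`) the identity reads
(closed form validated numerically, `code/disprove-g42/d4job/d4_validate.py`; not formalised here)
`Σ_{b ≠ a} e_{ab}·[B_b ∧ g]_K + Σ_{S = {a,b,c}} c_S·[B_b ∧ B_c]_K = 0` — `75` linear conditions on
(`e`, `c`) ⊗ (4-forms of `B`), which imply the `r` section parities of part 3 (`F_a + G_a = B_a ∧ [D_a]₄`).
PROBE (DISPROOF.md §48.9, job ids there): sampled over the TS₃ kernel of the cube-Z cells, the system
{D4, `F + G = 1`} in the `20` unknowns (`e`, `c`) was found inconsistent in every cell tested — the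
candidate two-sided mechanism "TS₃ ∧ D4 ∧ E∅ ⟹ ⊥" replaces the PAIR rows of THEOREM-CANDIDATE P by
one-sided, kernel-checked identities. HONEST FRAMING: the value here is a THEOREM (kernel-checked
necessary conditions on the last Maiorana–McFarland habitat of `NearExactIsExact`; one-sided: they
constrain, they do not decide), NOT summit progress; the crux and the summit are untouched.
-/

set_option linter.dupNamespace false -- D-0017: single-problem summit ⇒ `QuantumAdvantage.QuantumAdvantage` by design

namespace Summit.QuantumAdvantage.QuantumAdvantage.Theorems.NearExactIsExact.Negative.SectionDerivativeCube

open Finset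
open Literature.Computability.QuantumComplexity
open Summit.QuantumAdvantage.QuantumAdvantage.Theorems.CubicForrelation.NearExactIsExact
  (fc_isDegLeFun_comp fc_deg_bxor stub_axParity ax_card_cube_sup)
open Summit.QuantumAdvantage.QuantumAdvantage.Theorems.NearExactIsExact.Negative.BqqSeven
  (natCast_eq_zero_of_even)
open Summit.QuantumAdvantage.QuantumAdvantage.Theorems.NearExactIsExact.Negative.SkewProductCore
open Summit.QuantumAdvantage.QuantumAdvantage.Theorems.NearExactIsExact.Negative.SkewProductResidual
open Summit.QuantumAdvantage.QuantumAdvantage.Theorems.NearExactIsExact.Negative.ReflectedPairIdentity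
  (bool_aux1 bool_aux2 section_coord_deg)

variable {r : ℕ}

/-! ### ANF coefficients above the degree vanish (Ax on subcubes) -/

/-- A Boolean function of degree `≤ d` on `n` bits has EVEN weight on every coordinate subcube
`{u : supp u ⊆ K}` of dimension `|K| > d` (Ax / McEliece: the subcube weight is divisible by
`2^{⌈|K|/d⌉ − 1} ≥ 2`); equivalently its ANF coefficient `[u_K] = Σ_{supp u ⊆ K} f(u) ∈ 𝔽₂` is `0`.
[folklore] -/
theorem cube_sum_ind_eq_zero {n d : ℕ} (hd : 1 ≤ d) {F : (Fin n → Bool) → Bool} (hF : IsDegLeFun d F)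
    (K : Finset (Fin n)) (hK : d < K.card) :
    ∑ x ∈ {u : Fin n → Bool | ∀ i, u i = true → i ∈ K}, ind (F x) = 0 := by
  obtain ⟨z, hz⟩ := stub_axParity n d F K hd hF
  set S : Finset (Fin n → Bool) := {u : Fin n → Bool | ∀ i, u i = true → i ∈ K} with hS
  have hcard : S.card = 2 ^ K.card := by
    have h := ax_card_cube_sup (n := n) (empty_subset K)
    rw [card_empty, Nat.sub_zero] at h
    rw [← h, hS]
    exact congrArg Finset.card (filter_congr fun x _ => by simp)
  have hw : ∑ x ∈ S, ind (F x) = ((S.filter fun x => F x = true).card : ZMod 2) := by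
    unfold ind
    exact (natCast_card_filter _ _).symm
  have hsign : ∑ x ∈ S, signOf (F x) =
      (S.card : ℝ) - 2 * ((S.filter fun x => F x = true).card : ℝ) := by
    have e : ∀ x, signOf (F x) = 1 - 2 * (if F x = true then (1 : ℝ) else 0) := fun x => by
      cases F x <;> norm_num [signOf]
    simp_rw [e]
    rw [sum_sub_distrib, ← mul_sum, ← natCast_card_filter, sum_const, nsmul_eq_mul, mul_one]
  obtain ⟨k, hk⟩ : ∃ k, K.card = k + 2 := ⟨K.card - 2, by omega⟩
  obtain ⟨m, hm⟩ : ∃ m, (K.card + d - 1) / d = m + 2 := by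
    have h2 : 2 ≤ (K.card + d - 1) / d := (Nat.le_div_iff_mul_le hd).2 (by omega)
    exact ⟨(K.card + d - 1) / d - 2, by omega⟩
  rw [hw]
  apply natCast_eq_zero_of_even
  rw [hm, hsign, hcard, hk] at hz
  push_cast at hz
  have h2 : (((S.filter fun x => F x = true).card : ℤ) : ℝ) =
      (((2 : ℤ) ^ (k + 1) - 2 ^ (m + 1) * z : ℤ) : ℝ) := by
    push_cast
    linear_combination (-(1 : ℝ) / 2) * hz
  have h3 : ((S.filter fun x => F x = true).card : ℤ) = 2 ^ (k + 1) - 2 ^ (m + 1) * z :=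
    Int.cast_injective h2
  have he : Even (((S.filter fun x => F x = true).card : ℤ)) :=
    ⟨2 ^ k - 2 ^ m * z, by rw [h3]; ring⟩
  exact (Int.even_coe_nat _).mp he

/-- The only point of weight `0` lies in every subcube: `Σ_{supp u ⊆ K} [u = 0] = 1`. [folklore] -/
theorem cube_sum_ind_delta {n : ℕ} (K : Finset (Fin n)) :
    ∑ x ∈ {u : Fin n → Bool | ∀ i, u i = true → i ∈ K}, ind (decide (∀ i, x i = false)) = 1 := by
  rw [Finset.sum_eq_single_of_mem (fun _ => false) (by simp)]
  · simp [ind]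
  · intro u _ hu
    have hu' : ¬ ∀ i, u i = false := fun h' => hu (funext h')
    simp [ind, hu']

/-! ### THEOREM D4: the section derivative is cubic -/

/-- Along an affine section through `B u ⊕ e_a` the `t_a`-derivative of the residual,
`D_a(u) = c₂(γu, Bu) ⊕ c₂(γu, Bu ⊕ e_a) = c₁(u, 0) ⊕ c₁(u, tsec_a u)`, is CUBIC in `u`
(ANY base map `γ`, ANY `B`). [folklore] -/
theorem sectionDerivative_deg (γ : (Fin 6 → Bool) → (Fin 6 → Bool)) (B : Fin r → (Fin 6 → Bool) → Bool)
    (c₁ c₂ : (Fin (6 + r) → Bool) → Bool) (h₁ : IsDegLeFun 3 c₁)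
    (a : Fin r) (t : (Fin 6 → Bool) → Fin r → Bool) (ht : ∀ k, IsDegLeFun 1 (fun u => t u k))
    (h0 : ∀ u, (c₁ (Fin.append u (fun _ => false)) ^^ c₂ (Fin.append (γ u) (fun k => B k u))) =
      decide (∀ i, u i = false))
    (hsec : ∀ u, (c₁ (Fin.append u (t u)) ^^
      c₂ (Fin.append (γ u) (fun k => decide (k = a) ^^ B k u))) = decide (∀ i, u i = false)) :
    IsDegLeFun 3 (fun u => c₂ (Fin.append (γ u) (fun k => B k u)) ^^
      c₂ (Fin.append (γ u) (fun k => decide (k = a) ^^ B k u))) := by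
  have e : (fun u => c₂ (Fin.append (γ u) (fun k => B k u)) ^^
      c₂ (Fin.append (γ u) (fun k => decide (k = a) ^^ B k u))) =
      fun u => c₁ (Fin.append u (fun _ => false)) ^^ c₁ (Fin.append u (t u)) := by
    funext u
    exact bool_aux2 _ _ _ _ _ (h0 u) (hsec u)
  rw [e]
  have hc0 : IsDegLeFun 3 (fun u => c₁ (Fin.append u (fun _ => false))) :=
    fc_isDegLeFun_comp h₁ (fun u => Fin.append u (fun _ => false))
      (section_coord_deg (fun _ _ => false) (fun _ => isDegLeFun_const 1 false)) (by norm_num)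
  have hca : IsDegLeFun 3 (fun u => c₁ (Fin.append u (t u))) :=
    fc_isDegLeFun_comp h₁ (fun u => Fin.append u (t u)) (section_coord_deg t ht) (by norm_num)
  exact fc_deg_bxor hc0 hca

/-- **THEOREM D4 (gen 42), raw form.** For ANY base map `γ`, ANY fibre map `B`, cubic `c₁, c₂`, a fibre
direction `a` with an affine section `tsec_a` and the two residual identities (zero section, section `a`):
for every coordinate set `K ⊆ Fin 6` with `|K| ≥ 4`,
`Σ_{supp u ⊆ K} Σ_{S ∋ a, |S| ≤ 3} (∏_{m ∈ S∖a} B_m(u))·C_S(γu) = 0` in `𝔽₂`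
— the ANF coefficients of degree `≥ 4` of the section derivative vanish (`22` identities per `a`).
[folklore] -/
theorem sectionDerivative_cube_identity (γ : (Fin 6 → Bool) → (Fin 6 → Bool))
    (B : Fin r → (Fin 6 → Bool) → Bool)
    (c₁ c₂ : (Fin (6 + r) → Bool) → Bool) (h₁ : IsDegLeFun 3 c₁) (h₂ : IsDegLeFun 3 c₂)
    (a : Fin r) (t : (Fin 6 → Bool) → Fin r → Bool) (ht : ∀ k, IsDegLeFun 1 (fun u => t u k))
    (h0 : ∀ u, (c₁ (Fin.append u (fun _ => false)) ^^ c₂ (Fin.append (γ u) (fun k => B k u))) =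
      decide (∀ i, u i = false))
    (hsec : ∀ u, (c₁ (Fin.append u (t u)) ^^
      c₂ (Fin.append (γ u) (fun k => decide (k = a) ^^ B k u))) = decide (∀ i, u i = false))
    (K : Finset (Fin 6)) (hK : 3 < K.card) :
    ∑ u ∈ {u : Fin 6 → Bool | ∀ i, u i = true → i ∈ K}, ∑ S ∈ (P3 r).filter (fun S => a ∈ S),
      (∏ m ∈ S.erase a, ind (B m u)) * ind (coefC c₂ S (γ u)) = 0 := by
  have hpt : ∀ u, ind (c₂ (Fin.append (γ u) (fun k => B k u)) ^^
      c₂ (Fin.append (γ u) (fun k => decide (k = a) ^^ B k u))) =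
      ∑ S ∈ (P3 r).filter (fun S => a ∈ S), (∏ m ∈ S.erase a, ind (B m u)) * ind (coefC c₂ S (γ u)) := by
    intro u
    have e1 : texp (fun S (_ : Fin 6 → Bool) => coefC c₂ S (γ u))
        (fun j => decide (j = a) ^^ B j u) (γ u) =
        ind (c₂ (Fin.append (γ u) (fun k => decide (k = a) ^^ B k u))) := by
      rw [expand c₂ h₂]; rfl
    have e2 : texp (fun S (_ : Fin 6 → Bool) => coefC c₂ S (γ u)) (fun j => B j u) (γ u) =
        ind (c₂ (Fin.append (γ u) (fun k => B k u))) := by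
      rw [expand c₂ h₂]; rfl
    have hder := tcoef_eq (fun m (_ : Fin 6 → Bool) => B m u)
      (fun S (_ : Fin 6 → Bool) => coefC c₂ S (γ u)) a (γ u)
    rw [e1, e2, ← ind_xor] at hder
    rw [Bool.xor_comm, ← hder, tcoef]
  have hz := cube_sum_ind_eq_zero (by norm_num)
    (sectionDerivative_deg γ B c₁ c₂ h₁ a t ht h0 hsec) K hK
  rw [sum_congr rfl (fun u _ => hpt u)] at hz
  exact hz

/-- **Zero-section companion.** With the zero-section residual identity alone (`c₁` cubic, ANY `γ`, `B`,
`c₂`): `Σ_{supp u ⊆ K} c₂(γu, Bu) = 1` for every `|K| ≥ 4` — the ANF coefficients of degree `≥ 4` of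
`u ↦ c₂(γu, Bu)` all equal those of `[u = 0]`, namely `1` (`22` identities; `K = Fin 6` is the parity
behind THEOREM ZP). [folklore] -/
theorem zeroSection_cube_identity (γ : (Fin 6 → Bool) → (Fin 6 → Bool)) (B : Fin r → (Fin 6 → Bool) → Bool)
    (c₁ c₂ : (Fin (6 + r) → Bool) → Bool) (h₁ : IsDegLeFun 3 c₁)
    (h0 : ∀ u, (c₁ (Fin.append u (fun _ => false)) ^^ c₂ (Fin.append (γ u) (fun k => B k u))) =
      decide (∀ i, u i = false))
    (K : Finset (Fin 6)) (hK : 3 < K.card) :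
    ∑ u ∈ {u : Fin 6 → Bool | ∀ i, u i = true → i ∈ K}, ind (c₂ (Fin.append (γ u) (fun k => B k u))) = 1 := by
  have hc0 : IsDegLeFun 3 (fun u => c₁ (Fin.append u (fun _ => false))) :=
    fc_isDegLeFun_comp h₁ (fun u => Fin.append u (fun _ => false))
      (section_coord_deg (fun _ _ => false) (fun _ => isDegLeFun_const 1 false)) (by norm_num)
  have hz := cube_sum_ind_eq_zero (by norm_num) hc0 K hK
  have hpt : ∀ u, ind (c₁ (Fin.append u (fun _ => false))) =
      ind (c₂ (Fin.append (γ u) (fun k => B k u))) + ind (decide (∀ i, u i = false)) := by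
    intro u
    rw [← ind_xor, bool_aux1 _ _ _ (h0 u)]
  rw [sum_congr rfl (fun u _ => hpt u), sum_add_distrib, cube_sum_ind_delta] at hz
  -- `x + 1 = 0` in `𝔽₂`
  have h2 : ∀ x : ZMod 2, x + 1 = 0 → x = 1 := by decide
  exact h2 _ hz

end Summit.QuantumAdvantage.QuantumAdvantage.Theorems.NearExactIsExact.Negative.SectionDerivativeCube
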